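import Summits.ResolutionOfSingularities.ResolutionOfSingularities.Theorems.WeightedInvariantHypersurfaceLocalGameEFT4SDimLETwo
import Summits.ResolutionOfSingularities.ResolutionOfSingularities.Theorems.WeightedInvariantHypersurfaceLocalGameEFT4SDimOneGameRad
import Summits.ResolutionOfSingularities.ResolutionOfSingularities.Theorems.WeightedInvariantIotaOrder
import Summits.ResolutionOfSingularities.ResolutionOfSingularities.Theorems.WeightedInvariantContactCentreFiltration
import HarnessLib

/-!
# The game clause (c9′)↾≤2 of the P2 rung for `ι = iotaOrd`: reduction to Krull dimension EXACTLY two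

Topic: `Summits/ResolutionOfSingularities/ResolutionOfSingularities/Theorems`. Helper for the door item
`HypersurfaceCentreConstruction` (statement `stmt-ResolutionOfSingularities-19897`, route `WeightedInvariant`), line
`local-engine` of `res-L1-w43-plan-1`, KEY RUNG P2 (ORDER (o24), target `P2Rung p iotaOrd jContact` of
`…HypersurfaceLocalGameEFT4SDimLETwo`, res-type-073 p512950): plan-1 DEALS gen 9 #9 (b) «dim-1 adapters» → res-type-025.

`CanonicalGameClauseLE2 p iotaOrd J` quantifies over regular local positions `S` of Krull dimension `≤ 2` carrying
`0 ≠ f ∈ 𝔪²`. Dimension `0` is vacuous (`S` is a field, `𝔪 = ⊥`, so `f ∈ 𝔪² = ⊥`); dimension `1` is res-type-005's P1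
theorem `canonicalGameClause_dimOne_of_isoInvariant` (p510636) for every iso-invariant `J` that is `𝔪ᵐ` at the non-zero
non-units of discrete valuation rings (`ι := iotaOrd`, iso-invariant by res-type-073's `iotaOrd_isoInvariant`, p502169).
Hence, for such `J`, **the clause (c9′)↾≤2 for `iotaOrd` follows from its body at the positions of Krull dimension
EXACTLY `2`** (`canonicalGameClauseLE2_iotaOrd_of_dimTwo`) — the shape the (o24-G) hand (res-type-098) proves for
`J := jContact`, whose two `J`-hypotheses are res-type-092's `jContact_isoInvariant` / `jContact_eq_pow_of_DVR` ((o24-D)).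
No mathematics beyond bookkeeping of `ringKrullDim S ∈ {0, 1, 2}`.

[OURS · L1 W4.3] Replaces the role of NO printed item; NOT a statement of the manuscript
[claim: Hironaka2017, status: under-review]. AI work, weaker than expert review.
-/

noncomputable section

open IsLocalRing Literature.AlgebraicGeometry.Resolution
open Summit.ResolutionOfSingularities.ResolutionOfSingularities.Cruxes.HypersurfaceCentreConstruction.LocalEngine

set_option linter.dupNamespace false -- mandated namespace of this single-conjunct summit

namespace Summit.ResolutionOfSingularities.ResolutionOfSingularities.Theorems

namespace LocalGameEFT4SDimLETwo

/-- The Krull dimension of a Noetherian local ring is a natural number. [cite: Matsumura1987, Thm. 13.5] -/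
private theorem exists_ringKrullDim_eq_natCast (S : Type) [CommRing S] [IsNoetherianRing S] [IsLocalRing S] :
    ∃ d : ℕ, ringKrullDim S = d := by
  have h1 := ringKrullDim_ne_bot (R := S)
  have h2 := ringKrullDim_ne_top (R := S)
  obtain ⟨a, ha⟩ := WithBot.ne_bot_iff_exists.mp h1
  have ha' : a ≠ ⊤ := by
    rintro rfl
    exact h2 ha.symm
  obtain ⟨d, hd⟩ := ENat.ne_top_iff_exists.mp ha'
  exact ⟨d, by rw [← ha, ← hd, WithBot.coe_natCast]⟩

/-- In a regular local ring of Krull dimension `≤ 0` (a field) no non-zero element lies in `𝔪²`. [folklore] -/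
private theorem false_of_ringKrullDim_le_zero (S : Type) [CommRing S] [IsRegularLocalRing S]
    (hdim : ringKrullDim S ≤ 0) {f : S} (hf0 : f ≠ 0) (hf2 : f ∈ (maximalIdeal S) ^ 2) : False := by
  haveI := isDomain_of_isRegularLocalRing S
  haveI : Ring.KrullDimLE 0 S := Ring.krullDimLE_iff.mpr (by exact_mod_cast hdim)
  have hbot : maximalIdeal S = ⊥ :=
    IsLocalRing.isField_iff_maximalIdeal_eq.mp Ring.KrullDimLE.isField_of_isDomain
  rw [hbot, Ideal.bot_pow (n := 2) two_ne_zero] at hf2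
  · exact hf0 (Ideal.mem_bot.mp hf2)

/-- **The body of (c9′)↾≤2 for `ι = iotaOrd` at Krull dimension `≤ 1`**, for every iso-invariant `J` with `J R g m = 𝔪ᵐ`
at the non-zero non-units `g` of discrete valuation rings `R`: dimension `0` is vacuous and dimension `1` is
res-type-005's `canonicalGameClause_dimOne_of_isoInvariant` (p510636) with `iotaOrd_isoInvariant`.
[OURS · L1 W4.3 · P2 rung, dim ≤ 1 adapter] -/
theorem canonicalGameClauseLE2_body_iotaOrd_of_ringKrullDim_le_one
    (J : (R : Type) → [CommRing R] → R → ℕ → Ideal R) (hJiso : JIsoInvariant J)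
    (hJ : ∀ (R : Type) [CommRing R] [IsDomain R] [IsDiscreteValuationRing R] (g : R),
      g ≠ 0 → g ∈ maximalIdeal R → ∀ m : ℕ, J R g m = (maximalIdeal R) ^ m)
    (S : Type) [CommRing S] [IsRegularLocalRing S] (hdim : ringKrullDim S ≤ 1)
    (f : S) (hf0 : f ≠ 0) (hf2 : f ∈ (maximalIdeal S) ^ 2) :
    ∃ (P : Ideal S), P.IsPrime ∧ IsRegularLocalRing (S ⧸ P) ∧ f ∈ P ∧
      (∀ (𝔭 : Ideal S) [𝔭.IsPrime], f ∈ 𝔭 →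
        (iotaOrd (Localization.AtPrime 𝔭) (algebraMap S (Localization.AtPrime 𝔭) f) = iotaOrd S f ↔ P ≤ 𝔭)) ∧
      (∀ (𝔭 : Ideal S) [𝔭.IsPrime], f ∈ 𝔭 → P ≤ 𝔭 → ∀ m : ℕ,
        J (Localization.AtPrime 𝔭) (algebraMap S (Localization.AtPrime 𝔭) f) m =
          (J S f m).map (algebraMap S (Localization.AtPrime 𝔭))) ∧
      ∃ (n : ℕ) (u : Fin n → S) (w : Fin n → ℕ),
        Ideal.span (Set.range u) = maximalIdeal S ∧ (maximalIdeal S).spanFinrank = n ∧ (∃ i, 0 < w i) ∧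
        Ideal.span {x | ∃ i, 0 < w i ∧ x = u i} = P ∧
        (∀ m : ℕ, weightedMonomialIdeal u w m = J S f m) ∧
        (∀ (Q : Ideal S) [Q.IsPrime], P ≤ Q →
          algebraMap S (Localization.AtPrime Q) f ∈ (maximalIdeal (Localization.AtPrime Q)) ^ 2) ∧
        ∀ (𝔫 : Ideal (cobordantAlgebra' u w)) [𝔫.IsPrime],
          cobordantT' u w ∈ 𝔫 →
          P.map (algebraMap S (cobordantAlgebra' u w)) ≤ 𝔫 →
          ¬ (extReesAlgebra.vertexIdeal (weightedMonomialIdeal u w) ≤ 𝔫) →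
          ∀ (a : ℕ) (g : cobordantAlgebra' u w),
            algebraMap S (cobordantAlgebra' u w) f = cobordantT' u w ^ a * g →
            ¬ (cobordantT' u w ∣ g) →
            algebraMap (cobordantAlgebra' u w) (Localization.AtPrime 𝔫) g ∈
              (maximalIdeal (Localization.AtPrime 𝔫)) ^ 2 →
            iotaOrd (Localization.AtPrime 𝔫) (algebraMap (cobordantAlgebra' u w) (Localization.AtPrime 𝔫) g) <
              iotaOrd S f := by
  obtain ⟨d, hd⟩ := exists_ringKrullDim_eq_natCast S
  have hd1 : d ≤ 1 := by
    rw [hd] at hdim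
    exact_mod_cast hdim
  rcases Nat.le_one_iff_eq_zero_or_eq_one.mp hd1 with rfl | rfl
  · exact (false_of_ringKrullDim_le_zero S (by rw [hd]; exact_mod_cast le_rfl) hf0 hf2).elim
  · exact canonicalGameClause_dimOne_of_isoInvariant iotaOrd iotaOrd_isoInvariant J hJiso hJ S
      (by rw [hd]; rfl) f hf0 hf2

/-- **(c9′)↾≤2 for `ι = iotaOrd` from its body at Krull dimension EXACTLY two.** For every iso-invariant `J` with
`J R g m = 𝔪ᵐ` at the non-zero non-units of discrete valuation rings, `CanonicalGameClauseLE2 p iotaOrd J` follows from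
the same body demanded only at the positions `S` with `ringKrullDim S = 2` (dimension `≤ 1` by
`canonicalGameClauseLE2_body_iotaOrd_of_ringKrullDim_le_one`). For `J := jContact` the two `J`-hypotheses are res-type-092's
`jContact_isoInvariant` and `jContact_eq_pow_of_DVR` ((o24-D)), and the dimension-`2` body is the (o24-G) hand's theorem.
[OURS · L1 W4.3 · P2 rung, (o24-G) assembly combinator] -/
theorem canonicalGameClauseLE2_iotaOrd_of_dimTwo (p : ℕ)
    (J : (R : Type) → [CommRing R] → R → ℕ → Ideal R) (hJiso : JIsoInvariant J)
    (hJ : ∀ (R : Type) [CommRing R] [IsDomain R] [IsDiscreteValuationRing R] (g : R),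
      g ≠ 0 → g ∈ maximalIdeal R → ∀ m : ℕ, J R g m = (maximalIdeal R) ^ m)
    (h2 : ∀ (k₀ : Type) [Field k₀] [CharP k₀ p] [PerfectField k₀]
      (S : Type) [CommRing S] [Algebra k₀ S] [Algebra.EssFiniteType k₀ S] [IsRegularLocalRing S]
      (f : S), ringKrullDim S = 2 → f ≠ 0 → f ∈ (maximalIdeal S) ^ 2 →
      ∃ (P : Ideal S), P.IsPrime ∧ IsRegularLocalRing (S ⧸ P) ∧ f ∈ P ∧
        (∀ (𝔭 : Ideal S) [𝔭.IsPrime], f ∈ 𝔭 →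
          (iotaOrd (Localization.AtPrime 𝔭) (algebraMap S (Localization.AtPrime 𝔭) f) = iotaOrd S f ↔ P ≤ 𝔭)) ∧
        (∀ (𝔭 : Ideal S) [𝔭.IsPrime], f ∈ 𝔭 → P ≤ 𝔭 → ∀ m : ℕ,
          J (Localization.AtPrime 𝔭) (algebraMap S (Localization.AtPrime 𝔭) f) m =
            (J S f m).map (algebraMap S (Localization.AtPrime 𝔭))) ∧
        ∃ (n : ℕ) (u : Fin n → S) (w : Fin n → ℕ),
          Ideal.span (Set.range u) = maximalIdeal S ∧ (maximalIdeal S).spanFinrank = n ∧ (∃ i, 0 < w i) ∧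
          Ideal.span {x | ∃ i, 0 < w i ∧ x = u i} = P ∧
          (∀ m : ℕ, weightedMonomialIdeal u w m = J S f m) ∧
          (∀ (Q : Ideal S) [Q.IsPrime], P ≤ Q →
            algebraMap S (Localization.AtPrime Q) f ∈ (maximalIdeal (Localization.AtPrime Q)) ^ 2) ∧
          ∀ (𝔫 : Ideal (cobordantAlgebra' u w)) [𝔫.IsPrime],
            cobordantT' u w ∈ 𝔫 →
            P.map (algebraMap S (cobordantAlgebra' u w)) ≤ 𝔫 →
            ¬ (extReesAlgebra.vertexIdeal (weightedMonomialIdeal u w) ≤ 𝔫) →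
            ∀ (a : ℕ) (g : cobordantAlgebra' u w),
              algebraMap S (cobordantAlgebra' u w) f = cobordantT' u w ^ a * g →
              ¬ (cobordantT' u w ∣ g) →
              algebraMap (cobordantAlgebra' u w) (Localization.AtPrime 𝔫) g ∈
                (maximalIdeal (Localization.AtPrime 𝔫)) ^ 2 →
              iotaOrd (Localization.AtPrime 𝔫) (algebraMap (cobordantAlgebra' u w) (Localization.AtPrime 𝔫) g) <
                iotaOrd S f) :
    CanonicalGameClauseLE2 p iotaOrd J := by
  intro k₀ _ _ _ S _ _ _ _ f hdim hf0 hf2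
  by_cases hle : ringKrullDim S ≤ 1
  · exact canonicalGameClauseLE2_body_iotaOrd_of_ringKrullDim_le_one J hJiso hJ S hle f hf0 hf2
  · have h2' : ringKrullDim S = 2 := by
      obtain ⟨d, hd⟩ := exists_ringKrullDim_eq_natCast S
      rw [hd] at hdim hle ⊢
      have hd2 : d ≤ 2 := by exact_mod_cast hdim
      have hd1 : ¬ d ≤ 1 := fun h => hle (by exact_mod_cast h)
      have : d = 2 := by omega
      rw [this]; rfl
    exact h2 k₀ S f h2' hf0 hf2

/-! ## rev 2 — monomial type below Krull dimension two (for the (o24-O) assembly, res-type-005 p516179 ff.) -/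

/-- **Every non-zero element of a discrete valuation ring is of monomial type** (`f = u ϖᵏ`, `ϖ` a uniformiser, which
lies in `𝔪 ∖ 𝔪²`; units have `k = 0`). [cite: Matsumura1987, Thm. 11.2] -/
theorem isMonomialType_of_isDiscreteValuationRing (R : Type) [CommRing R] [IsDomain R] [IsDiscreteValuationRing R]
    {f : R} (hf0 : f ≠ 0) : IsMonomialType f := by
  obtain ⟨ϖ, hirr⟩ := IsDiscreteValuationRing.exists_irreducible R
  have h𝔪 : maximalIdeal R = Ideal.span {ϖ} := (IsDiscreteValuationRing.irreducible_iff_uniformizer ϖ).mp hirr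
  obtain ⟨k, u, hfu⟩ := IsDiscreteValuationRing.eq_unit_mul_pow_irreducible hf0 hirr
  have hϖ : ϖ ∈ maximalIdeal R := by
    rw [h𝔪]
    exact Ideal.mem_span_singleton_self ϖ
  have hϖ2 : ϖ ∉ maximalIdeal R ^ 2 := by
    rw [h𝔪, Ideal.span_singleton_pow, Ideal.mem_span_singleton]
    intro h
    have h1 : ϖ * ϖ ∣ ϖ * 1 := by rwa [mul_one, ← pow_two]
    exact hirr.not_isUnit (isUnit_of_dvd_one ((mul_dvd_mul_iff_left hirr.ne_zero).mp h1))
  exact ⟨u, ϖ, k, u.isUnit, hϖ, hϖ2, hfu⟩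

/-- **Below Krull dimension two every non-zero non-unit of a regular local ring is of monomial type**: dimension `0` is
vacuous (`𝔪 = ⊥`), dimension `1` is the discrete-valuation-ring case. [OURS · L1 W4.3 · P2 rung, dim ≤ 1 adapter] -/
theorem isMonomialType_of_ringKrullDim_le_one (S : Type) [CommRing S] [IsRegularLocalRing S]
    (hdim : ringKrullDim S ≤ 1) {f : S} (hf0 : f ≠ 0) (hf : f ∈ maximalIdeal S) : IsMonomialType f := by
  haveI := isDomain_of_isRegularLocalRing S
  obtain ⟨d, hd⟩ := exists_ringKrullDim_eq_natCast S
  have hd1 : d ≤ 1 := by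
    rw [hd] at hdim
    exact_mod_cast hdim
  rcases Nat.le_one_iff_eq_zero_or_eq_one.mp hd1 with rfl | rfl
  · haveI : Ring.KrullDimLE 0 S := Ring.krullDimLE_iff.mpr hd.le
    have hbot : maximalIdeal S = ⊥ :=
      IsLocalRing.isField_iff_maximalIdeal_eq.mp Ring.KrullDimLE.isField_of_isDomain
    rw [hbot] at hf
    exact (hf0 (Ideal.mem_bot.mp hf)).elim
  · haveI : IsDiscreteValuationRing S :=
      Literature.RingTheory.RegularLocalRing.isDiscreteValuationRing_of_ringKrullDim_eq_one (by rw [hd]; rfl)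
    exact isMonomialType_of_isDiscreteValuationRing S hf0

/-- **A non-zero non-unit NOT of monomial type lives in Krull dimension exactly two** (given `≤ 2`): the case split of
the (o24-O)/(o24-G) assemblies («dim 0: `f = 0`; dim 1: DVR ⇒ monomial type»).
[OURS · L1 W4.3 · P2 rung, dim ≤ 1 adapter] -/
theorem ringKrullDim_eq_two_of_not_isMonomialType (S : Type) [CommRing S] [IsRegularLocalRing S]
    (hdim : ringKrullDim S ≤ 2) {f : S} (hf0 : f ≠ 0) (hf : f ∈ maximalIdeal S) (hnm : ¬ IsMonomialType f) :
    ringKrullDim S = 2 := by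
  by_cases hle : ringKrullDim S ≤ 1
  · exact (hnm (isMonomialType_of_ringKrullDim_le_one S hle hf0 hf)).elim
  · obtain ⟨d, hd⟩ := exists_ringKrullDim_eq_natCast S
    rw [hd] at hdim hle ⊢
    have hd2 : d ≤ 2 := by exact_mod_cast hdim
    have hd1 : ¬ d ≤ 1 := fun h => hle (by exact_mod_cast h)
    have : d = 2 := by omega
    rw [this]; rfl

/-- The same at a localization `A_𝔪` in the binders of `JOpenPresentationForallSingLE2` (`F/1 ≠ 0`, `F/1 ∈ 𝔪²`,
`ringKrullDim A_𝔪 ≤ 2`, not of monomial type ⇒ `ringKrullDim A_𝔪 = 2`). [OURS · L1 W4.3 · P2 rung, dim ≤ 1 adapter] -/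
theorem ringKrullDim_localization_eq_two_of_not_isMonomialType {A : Type} [CommRing A] (𝔪 : Ideal A) [𝔪.IsPrime]
    (hreg : IsRegularLocalRing (Localization.AtPrime 𝔪)) (hdim : ringKrullDim (Localization.AtPrime 𝔪) ≤ 2) {F : A}
    (hF0 : algebraMap A (Localization.AtPrime 𝔪) F ≠ 0)
    (hF2 : algebraMap A (Localization.AtPrime 𝔪) F ∈ (maximalIdeal (Localization.AtPrime 𝔪)) ^ 2)
    (hnm : ¬ IsMonomialType (algebraMap A (Localization.AtPrime 𝔪) F)) :
    ringKrullDim (Localization.AtPrime 𝔪) = 2 :=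
  haveI := hreg
  ringKrullDim_eq_two_of_not_isMonomialType (Localization.AtPrime 𝔪) hdim hF0
    (Ideal.pow_le_self two_ne_zero hF2) hnm

end LocalGameEFT4SDimLETwo

end Summit.ResolutionOfSingularities.ResolutionOfSingularities.Theorems

end
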